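import Summits.CriticalPhenomena.PercolationContinuityZ3.Theorems.PercNearOneGluingNoHeavyQuantTreeBuiltCells
import HarnessLib

/-!
# QUANT lane R8, T-DEC: `TreeBuiltAD3` ALONE implies `SDECConvClosedTB`, `TreeBuiltDEC` and `FarTreeRow` — an AD3⁺ decomposition carries
# the admissibility of its components, hence of the law (kernel); the honest reading of `…QuantTreeBuiltCells`

builds on p205010 (kernel theorem, internal audit signed; external expert review pending)

Support file (`--supports stmt-CriticalPhenomena-4575`), QUANT lane, TYPER seat prim-quant-stmt (gen 31), rung R8 of
`run/shared/lean/prim/quant/LADDER.md`; companion (and CORRECTION OF EMPHASIS) of `…QuantTreeBuiltCells`.  Theorems only, standard axioms,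
no sorries, no definitions.

THE OBSERVATION.  An AD3⁺ decomposition (`LawDec.AD3Decomp y q T M μ`) writes `μ` as a finite mixture of laws of the common mean `T` each of
which has its `q`-gated version DEC at every layer `j′ < M` at floor `y`: light pairs and triples BY THE DATUM THEY CARRY, heavy pairs
`{lo, hi; γ}`, `y ≤ qγ`, UNCONDITIONALLY (`heavyPair_gate_decAt`: below `hi` the giant `hi` absorbs everything at gate `y` — criterion E is
`y ≤ qγ ≤ mass of the giants` —, at and above `hi` Theorem A).  A finite mixture at a common target is DEC (`decAtT_finite_mixture`), so
`gate_q μ` is DEC at every layer (`gate_decAt_of_AD3Decomp`).  CONSEQUENTLY `TreeBuiltAD3` (every tree-built law is AD3⁺-decomposable at every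
gate) implies, ON ITS OWN, that every tree-built law is SDEC (`treeBuilt_sdec_of_treeBuiltAD3`), hence `SDECConvClosedTB`, `TreeBuiltDEC`,
`TreeBuiltFAR` and `Quant.FarTreeRow` (`farTreeRow_of_treeBuiltAD3`) — the hypotheses CW + PP + PT + TT of `farTreeRow_of_bothLightCells`
(`…QuantTreeBuiltCells`) are REDUNDANT next to `TreeBuiltAD3`.  HONEST READING OF THE LANDSCAPE (typer g31, memo
`run/shared/lean/prim/quant/prim-quant-stmt-g31/SGC-CELLS-G31.md` §4–§6):
* ROUTE 1 (the lane's): `SingleGateConvClosed` for ALL admissible pairs ⟸ CW (node `GatedSliceMixLaw'`) + the light cells (L2/L3, or PP/PT/TT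
  when both factors are AD3⁺-decomposed) — complete EXCEPT at pairs with a non-AD3⁺ factor (arm-2 g35's vertex; lead g31 N123's dual route).
* ROUTE 2 (this file): `FarTreeRow ⟸ TreeBuiltAD3`; any decomposition ORACLE strong enough to feed the light cells already contains the DEC
  information, so for TREE targets the cells add nothing to the oracle; the content of Route 2 is an INDUCTIVE proof of `TreeBuiltAD3` through
  explicit decomposition cells (gate of a component, product of two components — typed in `…QuantTreeBuiltAD3Cells`; exact census 9 560 / 0 and
  2 350 / 0), which bypasses CW and SGC entirely.  Whether those decomposition cells are easier than Route 1's inequalities is open.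
EVIDENCE for `TreeBuiltAD3`: exact census 34 718 (law, gate, floor) instances / 0 (typer g31).  HONEST STATUS: `TreeBuiltAD3`, `SDECConvClosedTB`,
`TreeBuiltDEC`, `FarTreeRow` OPEN; RATE class log\* / honest sentence unchanged.

* `LawDec.heavyPair_gate_decAt` — a top-affordable HEAVY pair is an admissible factor: `gate_q{lo, hi; γ}` is DEC at every layer `j′ < M`.
* `LawDec.gate_decAt_of_AD3Decomp` — law facts + admissibility of an AD3⁺-decomposed law.
* **`LawDec.treeBuilt_sdec_of_treeBuiltAD3`**, `LawDec.sdecConvClosedTB_of_treeBuiltAD3`, **`LawDec.treeBuiltDEC_of_treeBuiltAD3`**,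
  `LawDec.treeBuiltFAR_of_treeBuiltAD3`, **`farTreeRow_of_treeBuiltAD3 : LawDec.TreeBuiltAD3 → Quant.FarTreeRow`**.

[this work]; criterion E / Theorem A: prim-quant-census-2 g52 / prim-quant-stmt g18; mixtures: prim-quant-stmt g22 (this lane).  The gluing rows
served [cite: KozmaNitzan2024, Conjecture 3 (p. 15)]; product measure [cite: Grimmett1999, §1.3 p. 10].
-/

noncomputable section

namespace Summit.CriticalPhenomena.PercolationContinuityZ3.Theorems

namespace Quant

open Finset

/-- two-point law notation `TP[lo, hi, g, h] = g·[h = hi] + (1 − g)·[h = lo]` (as in the lane's other files). -/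
local notation3 "TP[" lo ", " hi ", " g ", " h "]" =>
  (g : ℝ) * (if (h : ℕ) = (hi : ℕ) then (1 : ℝ) else 0) + (1 - (g : ℝ)) * (if (h : ℕ) = (lo : ℕ) then (1 : ℝ) else 0)

/-- three-atom law notation `TR[s₁, s₂, s₃, p₁, p₂, p₃, h] = p₁·[h = s₁] + p₂·[h = s₂] + p₃·[h = s₃]`. -/
local notation3 "TR[" s₁ ", " s₂ ", " s₃ ", " p₁ ", " p₂ ", " p₃ ", " h "]" =>
  (p₁ : ℝ) * (if (h : ℕ) = (s₁ : ℕ) then (1 : ℝ) else 0) + (p₂ : ℝ) * (if (h : ℕ) = (s₂ : ℕ) then (1 : ℝ) else 0)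
    + (p₃ : ℝ) * (if (h : ℕ) = (s₃ : ℕ) then (1 : ℝ) else 0)

namespace LawDec

/-! ### A heavy pair is an admissible factor -/

/-- **A TOP-AFFORDABLE HEAVY PAIR IS ADMISSIBLE.**  `lo ≤ hi ≤ M`, `γ ≤ 1`, floor `0 < y < 1`, gate `0 < q ≤ 1`, HEAVY `y ≤ q·γ`, top-affordable
`y·M ≤ q·(lo + (hi − lo)γ)`: then `gate_q{lo, hi; γ}` is DEC at every layer `j′ < M` at floor `y`.  Below `hi`: the mass above the layer is at least
`qγ ≥ y`, so criterion E (`decAt_of_giantsAbsorbLows`) applies; at and above `hi`: Theorem A on `{0..hi}` (`decAt_of_top_le`), top raised to `M`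
(`decAtT_mono_top`). [this work] -/
theorem heavyPair_gate_decAt (y q γ : ℝ) (M lo hi : ℕ) (hy0 : 0 < y) (hy1 : y < 1) (hq0 : 0 < q) (hq1 : q ≤ 1)
    (hlohi : lo ≤ hi) (hhi : hi ≤ M) (hγ1 : γ ≤ 1) (hheavy : y ≤ q * γ)
    (hta : y * (M : ℝ) ≤ q * ((lo : ℝ) + ((hi : ℝ) - lo) * γ)) :
    ∀ j', j' < M → DECAt y j' M (gate (fun h => TP[lo, hi, γ, h]) q) := by
  intro j' hj'
  have hγ0 : 0 ≤ γ := by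
    by_contra hlt; rw [not_le] at hlt
    have : q * γ < 0 := mul_neg_of_pos_of_neg hq0 hlt
    linarith
  set ν : ℕ → ℝ := gate (fun h => TP[lo, hi, γ, h]) q with hν
  -- law facts at top `M` and at top `hi`
  obtain ⟨hπ0, hπM, hπ1, hπmean⟩ := tp_laws M lo hi γ hγ0 hγ1 hlohi hhi
  obtain ⟨-, hπM', hπ1', hπmean'⟩ := tp_laws hi lo hi γ hγ0 hγ1 hlohi le_rfl
  obtain ⟨n0, nM, n1⟩ := gate_laws M (fun h => TP[lo, hi, γ, h]) q hq0.le hq1 hπ0 hπM hπ1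
  obtain ⟨-, nM', n1'⟩ := gate_laws hi (fun h => TP[lo, hi, γ, h]) q hq0.le hq1 hπ0 hπM' hπ1'
  have nmean : ∑ h ∈ Finset.range (M + 1), (h : ℝ) * ν h = q * ((lo : ℝ) + ((hi : ℝ) - lo) * γ) := by
    rw [hν, sum_mul_gate, hπmean]
  have nmean' : ∑ h ∈ Finset.range (hi + 1), (h : ℝ) * ν h = q * ((lo : ℝ) + ((hi : ℝ) - lo) * γ) := by
    rw [hν, sum_mul_gate, hπmean']
  by_cases hjh : j' < hi
  · -- criterion E: the giants carry at least `ν hi ≥ qγ ≥ y`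
    refine decAt_of_giantsAbsorbLows y j' M ν hj' n0 nM n1 hy0 ?_
    have hsplit := Finset.sum_range_add_sum_Ico ν (show j' + 1 ≤ M + 1 by omega)
    rw [n1] at hsplit
    have hG : q * γ ≤ ∑ h ∈ Finset.Ico (j' + 1) (M + 1), ν h := by
      have hmem : hi ∈ Finset.Ico (j' + 1) (M + 1) := Finset.mem_Ico.2 ⟨hjh, Nat.lt_succ_of_le hhi⟩
      refine le_trans ?_ (Finset.single_le_sum (fun h _ => n0 h) hmem)
      show q * γ ≤ q * (γ * (if hi = hi then (1 : ℝ) else 0) + (1 - γ) * (if hi = lo then (1 : ℝ) else 0))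
        + (if hi = 0 then 1 - q else 0)
      rw [if_pos rfl, mul_one]
      have h3 : 0 ≤ (1 - γ) * (if hi = lo then (1 : ℝ) else 0) := by
        have : 0 ≤ (if hi = lo then (1 : ℝ) else 0) := by split_ifs <;> norm_num
        exact mul_nonneg (by linarith) this
      have h0 : (0 : ℝ) ≤ (if hi = 0 then 1 - q else 0) := by split_ifs <;> linarith
      nlinarith [mul_nonneg hq0.le h3]
    have hlow : ∑ h ∈ Finset.range (j' + 1),
        (if 2 * (h : ℝ) < ∑ k ∈ Finset.range (M + 1), (k : ℝ) * ν k then ν h else 0) ≤ ∑ h ∈ Finset.range (j' + 1), ν h :=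
      Finset.sum_le_sum fun h _ => by split_ifs <;> [exact le_rfl; exact n0 h]
    have h1 : y * ∑ h ∈ Finset.range (j' + 1),
        (if 2 * (h : ℝ) < ∑ k ∈ Finset.range (M + 1), (k : ℝ) * ν k then ν h else 0) ≤ y * ∑ h ∈ Finset.range (j' + 1), ν h :=
      mul_le_mul_of_nonneg_left hlow hy0.le
    have h2 : ∑ h ∈ Finset.range (j' + 1), ν h = 1 - ∑ h ∈ Finset.Ico (j' + 1) (M + 1), ν h := by linarith
    rw [h2] at h1
    nlinarith
  · -- Theorem A on `{0..hi}`, then raise the top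
    rw [not_lt] at hjh
    have htop : ∀ h, 0 < ν h → y * (h : ℝ) ≤ ∑ k ∈ Finset.range (hi + 1), (k : ℝ) * ν k := by
      intro h hh
      have hhhi : h ≤ hi := by
        by_contra hlt; rw [not_le] at hlt
        exact absurd (nM' h hlt) (ne_of_gt hh)
      rw [nmean']
      have e1 : y * (h : ℝ) ≤ y * (hi : ℝ) := mul_le_mul_of_nonneg_left (by exact_mod_cast hhhi) hy0.le
      have e2 : y * (hi : ℝ) ≤ y * (M : ℝ) := mul_le_mul_of_nonneg_left (by exact_mod_cast hhi) hy0.le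
      linarith
    have hdec := decAt_of_top_le hi ν n0 nM' n1' y hy1 htop j' hjh
    rw [decAt_iff_decAtT, nmean'] at hdec
    rw [decAt_iff_decAtT, nmean]
    exact decAtT_mono_top hdec hhi

/-! ### An AD3⁺-decomposed law is admissible -/

/-- **LAW FACTS AND ADMISSIBILITY OF AN AD3⁺-DECOMPOSED LAW.**  If `AD3Decomp y q T M μ` (floor `0 < y < 1`, gate `0 < q ≤ 1`) and `y·M ≤ q·T`,
then `μ` is a probability law on `{0..M}` of mean `T` and `gate_q μ` is DEC at every layer `j′ < M` at floor `y` — each charged component is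
admissible (heavy pairs by `heavyPair_gate_decAt`, the others by their datum) and the gated law is their mixture at the common target `qT`
(`gate_sum_mixture`, `decAtT_finite_mixture`). [this work] -/
theorem gate_decAt_of_AD3Decomp (y q T : ℝ) (M : ℕ) (μ : ℕ → ℝ) (hy0 : 0 < y) (hy1 : y < 1) (hq0 : 0 < q) (hq1 : q ≤ 1)
    (hta : y * (M : ℝ) ≤ q * T) (hAD : AD3Decomp y q T M μ) :
    (∀ h, 0 ≤ μ h) ∧ (∀ h, M < h → μ h = 0) ∧ (∑ h ∈ Finset.range (M + 1), μ h = 1) ∧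
      (∑ h ∈ Finset.range (M + 1), (h : ℝ) * μ h = T) ∧ (∀ j', j' < M → DECAt y j' M (gate μ q)) := by
  obtain ⟨κ, _, v, ω, hv0, hv1, hμ, hcomp⟩ := hAD
  -- component law facts and admissibility
  have hlaw : ∀ k, 0 < v k → (∀ h, 0 ≤ ω k h) ∧ (∀ h, M < h → ω k h = 0) ∧
      (∑ h ∈ Finset.range (M + 1), ω k h = 1) ∧ (∑ h ∈ Finset.range (M + 1), (h : ℝ) * ω k h = T) ∧
      (∀ j', j' < M → DECAt y j' M (gate (ω k) q)) := by
    intro k hk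
    rcases hcomp k hk with ⟨lo, hi, γ, hlohi, hhi, hγ0, hγ1, hheavy, hmean, hω⟩ |
      ⟨lo, hi, γ, hlohi, hhi, hγ0, hγ1, -, hmean, hD, hω⟩ |
      ⟨s₁, s₂, s₃, p₁, p₂, p₃, h12, h23, h3, hp₁, hp₂, hp₃, hp, hT, -, hD, hω⟩
    · obtain ⟨a, b, c, d⟩ := tp_laws M lo hi γ hγ0 hγ1 hlohi hhi
      rw [hω]
      exact ⟨a, b, c, hmean ▸ d, heavyPair_gate_decAt y q γ M lo hi hy0 hy1 hq0 hq1 hlohi hhi hγ1 hheavy (hmean.symm ▸ hta)⟩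
    · obtain ⟨a, b, c, d⟩ := tp_laws M lo hi γ hγ0 hγ1 hlohi.le hhi
      rw [hω]; exact ⟨a, b, c, hmean ▸ d, hD⟩
    · obtain ⟨a, b, c, d⟩ := triple_laws' p₁ p₂ p₃ T M s₁ s₂ s₃ (by omega) (by omega) h3 hp₁.le hp₂.le hp₃.le hp hT
      rw [hω]; exact ⟨a, b, c, d, hD⟩
  obtain ⟨hμ1, hμmean⟩ := mixture_laws M T μ v ω hv0 hv1 hμ (fun k hk => (hlaw k hk).2.2.1) (fun k hk => (hlaw k hk).2.2.2.1)
  have hterm0 : ∀ k h, 0 ≤ v k * ω k h := by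
    intro k h
    rcases (hv0 k).eq_or_lt with hz | hpos
    · rw [← hz, zero_mul]
    · exact mul_nonneg hpos.le ((hlaw k hpos).1 h)
  have hμ0 : ∀ h, 0 ≤ μ h := fun h => by rw [hμ h]; exact Finset.sum_nonneg fun k _ => hterm0 k h
  have hμM : ∀ h, M < h → μ h = 0 := by
    intro h hh
    rw [hμ h]
    refine Finset.sum_eq_zero fun k _ => ?_
    rcases (hv0 k).eq_or_lt with hz | hpos
    · rw [← hz, zero_mul]
    · rw [(hlaw k hpos).2.1 h hh, mul_zero]
  refine ⟨hμ0, hμM, hμ1, hμmean, fun j' hj' => ?_⟩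
  rw [decAt_iff_decAtT, sum_mul_gate, hμmean]
  have hmix : ∀ h, gate μ q h = ∑ k, v k * gate (ω k) q h := by
    intro h
    rw [← gate_sum_mixture v ω q hv1 h]
    congr 1
    exact funext hμ
  refine decAtT_finite_mixture y (q * T) j' M (gate μ q) v (fun k => gate (ω k) q) hv0 hv1 hmix fun k hk => ?_
  have hd := (hlaw k hk).2.2.2.2 j' hj'
  rw [decAt_iff_decAtT, sum_mul_gate, (hlaw k hk).2.2.2.1] at hd
  exact hd

/-! ### `TreeBuiltAD3` alone -/

/-- **`TreeBuiltAD3 ⟹` every tree-built law is SDEC** (at its floor): for each gate `q`, the AD3⁺ decomposition at `(q·x, q)` makes `gate_q μ`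
DEC at every layer below the top (`gate_decAt_of_AD3Decomp`; top-affordability from `treeBuilt_lawFacts`). [this work] -/
theorem treeBuilt_sdec_of_treeBuiltAD3 (hA : TreeBuiltAD3) {x : ℝ} {M : ℕ} {μ : ℕ → ℝ} (h : TreeBuilt x M μ) : SDEC x M μ := by
  intro q hq0 hq1 j' hj'
  obtain ⟨hx0, hx1, -, -, -, hta⟩ := treeBuilt_lawFacts h
  have hta' : q * x * (M : ℝ) ≤ q * ∑ k ∈ Finset.range (M + 1), (k : ℝ) * μ k := by
    rw [mul_assoc]; exact mul_le_mul_of_nonneg_left hta hq0.le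
  exact (gate_decAt_of_AD3Decomp (q * x) q _ M μ (mul_pos hq0 hx0) (by nlinarith) hq0 hq1 hta' (hA x M μ h q hq0 hq1)).2.2.2.2
    j' hj'

/-- **`TreeBuiltAD3 ⟹ SDECConvClosedTB`** (the convolution of tree-built laws is tree-built). [this work] -/
theorem sdecConvClosedTB_of_treeBuiltAD3 (hA : TreeBuiltAD3) : SDECConvClosedTB :=
  fun _ _ _ _ _ h₁ h₂ _ _ => treeBuilt_sdec_of_treeBuiltAD3 hA (TreeBuilt.conv h₁ h₂)

/-- **`TreeBuiltAD3 ⟹ TreeBuiltDEC`**. [this work] -/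
theorem treeBuiltDEC_of_treeBuiltAD3 (hA : TreeBuiltAD3) : TreeBuiltDEC :=
  treeBuiltDEC_of_sdecConvClosedTB (sdecConvClosedTB_of_treeBuiltAD3 hA)

/-- **`TreeBuiltAD3 ⟹ TreeBuiltFAR`**. [this work] -/
theorem treeBuiltFAR_of_treeBuiltAD3 (hA : TreeBuiltAD3) : TreeBuiltFAR :=
  treeBuiltFAR_of_treeBuiltDEC (treeBuiltDEC_of_treeBuiltAD3 hA)

end LawDec

/-- **`TreeBuiltAD3 ⟹ Quant.FarTreeRow`** — the R8 tree row from the ONE structural conjecture "every tree-built law is AD3⁺-decomposable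
at every gate" (exact census 34 718 / 0).  CONDITIONAL on `TreeBuiltAD3` (OPEN). [this work] -/
theorem farTreeRow_of_treeBuiltAD3 (hA : LawDec.TreeBuiltAD3) : FarTreeRow :=
  farTreeRow_of_sdecConvClosedTB (LawDec.sdecConvClosedTB_of_treeBuiltAD3 hA)

end Quant

end Summit.CriticalPhenomena.PercolationContinuityZ3.Theorems
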